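import Summits.BirchSwinnertonDyer.BirchSwinnertonDyer.Theorems.GenusKolyvaginAtTwoPowDvdShaCardAtTwoRTKolyvaginSuppliesOfDeepSwapPred
import Summits.BirchSwinnertonDyer.BirchSwinnertonDyer.Theorems.GenusKolyvaginAtTwoPowDvdShaCardAtTwoRTKolyvaginSuppliesOfSockets
import Summits.BirchSwinnertonDyer.BirchSwinnertonDyer.Theorems.GenusKolyvaginAtTwoPowDvdShaCardAtTwoRTOrthogonalCapstoneFrame
import HarnessLib

/-!
# Route `GenusKolyvaginAtTwo`, LINE 18 (L_T `PowDvdShaCardAtTwoRT`, stmt-BirchSwinnertonDyer-23299, ex 23242) — ROAD (E4) ASSEMBLED BY NAME: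
# L_T's conclusion `2^{2M₀} ∣ #Ш(E_K)[2^∞]` from a GROSS WITNESS, modulo {Q2, P, (NPh) or the (D-NPh) place, a bi-additive `B` on `Ш[2^k]` with the
# level clause, and the ONE arithmetic socket X-ORTH (Cassels–Tate orthogonality of the (+)- and (−)-provenance classes)}

Seat `bsd-line-gk2-p2` g20 (PROVER seat 2/3, cell `bsd-f1-sign2`), `--supports stmt-BirchSwinnertonDyer-23299` (helper; closes nothing).
THEOREMS ONLY (no definition, no named fact, no `sorry`); BSD is not proved by any of this; neither is L_T.

WHAT.
* §1 `kolyvaginSuppliesAtTwo_of_grossWitness_pred`, `…_onHabitat_pred` — gk2-p3's by-name compositions over the three sockets (p735895: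
  `hbot_socket_margin(_onHabitat)_of_three_le`, LEAD's `deepSwap_socket`, gk2-p5's `hK_socket_margin`) re-run through
  `kolyvaginSuppliesAtTwo_of_deepSwap_pred`, so that the supplied levels REPORT the margin class
  `L + k ≤ idx ℓ ∧ FrobEqFrobInfty W K (2^(L+k)) ℓ` of every prime — the provenance X-ORTH's discharge needs (gk2-p4 memo §3(c)(i); lower the
  Frobenius level with `FrobEqFrobInfty.of_dvd`).
* §2 **`pow_dvd_natCard_sha_of_grossWitness_of_orthogonal`** and **`…_onHabitat`** — THE (E4) CLOSER MODULO ITS SOCKET: on L_T's frame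
  (habitat of `W`, `K`, `(Dt, β, ι, d₁)`, `y_1` of infinite order with `2^{M₀} ∥ P(1)`, `Δ < 0`, the first non-square clause, `τ ≠ 1`), with a level
  `L ≥ 2M₀ + 12`, margin `kₘ ≥ 1`, pairing exponent `k ≥ M₀`, a GROSS WITNESS (square-free `n₀` of level-4 Gross primes of index ≥ 2 with
  `addOrderOf c₂(n₀) = 4`, resp. on the cut habitat: level-2 Gross primes of index ≥ 2 with `P(n₀) ∉ 2E(K[n₀])` — the (β″) witness clause / W-UP
  output), a bi-additive `B` on `Ш(E_K)[2^k]` with the level clause, and X-ORTH in provenance currency for the margin class: THEN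
  `2^(2M₀) ∣ Nat.card (primaryComponent (W.baseChange K).sha 2)` — L_T's conclusion VERBATIM, displayed: `PubInputsAtTwo` (Kolyvagin conjunct),
  Q2 `KolyvaginRelationAtTwo`, (NPh_{L+kₘ}) in `2N`-form (first theorem) or nothing more (cut habitat), `B`+level clause, X-ORTH.  No twin, no genus
  budget, no Shallow/Deep split, no root-number split.  Intended instantiation (LEAD / gk2-p4): `L = 2k`, `B := ctLevelPairing … canonical`
  (`isLevelPairing_ctLevelPairing_canonical`), X-ORTH := McCallum Prop. 4.7 + the cross-sign local vanishing (p736279).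

References: [McCallumLMS1991] §4 Prop. 4.7, §5 Prop. 5.2, Thm. 5.4; [Kolyvagin1991StructureSha]; [Kolyvagin1991MathAnn] Thm. 2.1–2.2;
[GrossLMS1991] §3 (3.1)–(3.3), §5 Prop. 5.3–5.4; [LawsonWuthrich2016] §7.1.
-/

set_option autoImplicit false
-- the Theorems namespace of this sub repeats the summit name by design (D-0017 nested layout)
set_option linter.dupNamespace false

noncomputable section

open scoped Classical
open scoped AddSubgroup

namespace Summit.BirchSwinnertonDyer.BirchSwinnertonDyer.Theorems.GenusExact.PlusDescent

open WeierstrassCurve NumberField IsDedekindDomain Field Literature.NumberTheory.EllipticCurves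
  Literature.NumberTheory.GaloisRepresentations Literature.NumberTheory.EllipticCurves.ModularForms AddSubgroup
open Summit.BirchSwinnertonDyer.BirchSwinnertonDyer.Theses.GenusKolyvaginAtTwo (KolyvaginRelationAtTwo)
open Summit.BirchSwinnertonDyer.Rank1Residual

variable {K : Type} [Field K] [NumberField K]

/-! ## §1 The sockets' compositions with provenance -/

/-- **KS's registered conclusion WITH PROVENANCE from a level-`4` Gross witness, modulo Q2 and (NPh_{L+k})** — gk2-p3's
`kolyvaginSuppliesAtTwo_of_grossWitness` (p735895) re-run through `kolyvaginSuppliesAtTwo_of_deepSwap_pred`: the primes of the supplied levels are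
reported with the margin class `L + k ≤ idx ∧ FrobEqFrobInfty W K (2^(L+k))`.
[cite: McCallumLMS1991, §5 Prop. 5.2, Lemma 5.1, Cor. 4.5] [cite: Kolyvagin1991MathAnn, Thm. 2.1–2.2] [cite: GrossLMS1991, §3 (3.1)–(3.3)] -/
theorem kolyvaginSuppliesAtTwo_of_grossWitness_pred (W : WeierstrassCurve ℚ) [W.IsElliptic] [W.IsGloballyMinimal]
    [NeZero (W.conductorNorm ℤ)]
    (hQ2 : KolyvaginRelationAtTwo) (hcm : ¬ W.HasCM) (hΔ : W.Δ < 0) (hT : Odd W.tamagawaProduct)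
    (hρ : ∀ m : ℕ, W.HasSurjectiveModNGaloisRep (2 ^ m : ℕ))
    (hIQ : IsImaginaryQuadratic K) (hodd : Odd (NumberField.discr K)) (h3 : NumberField.discr K ≠ -3)
    (hHe : SatisfiesHeegnerHypothesis (W.conductorNorm ℤ) K) (hns : ¬ IsSquare ((NumberField.discr K : ℚ) * -|W.Δ|))
    (τ : K ≃ₐ[ℚ] K) (hτ : τ ≠ 1)
    (Dt : ModularParametrizationData W (W.conductorNorm ℤ)) (β : ℤ) (ι : K →+* ℂ)
    (d₁ : KolyvaginHeegnerData Dt β ι 1) (M₀ : ℕ)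
    (hM₀ : ∃ Q : (W.baseChange (ringClassField K ι 1)).toAffine.Point, ((2 ^ M₀ : ℕ) : ℤ) • Q = d₁.derivedPoint)
    (hndiv : ¬ ∃ Q : (W.baseChange (ringClassField K ι 1)).toAffine.Point, ((2 ^ (M₀ + 1) : ℕ) : ℤ) • Q = d₁.derivedPoint)
    {L k : ℕ} (hL : 2 * M₀ + 12 ≤ L) (hk : 1 ≤ k)
    (hNPh : ∀ z : galH1Torsion (W.baseChange K) ((2 ^ (L + k) : ℕ) : ℤ),
      (∀ ρ ∈ torsionFixing (W.baseChange K) ((2 ^ (L + k) : ℕ) : ℤ),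
        h1Eval (W.baseChange K) ((2 ^ (L + k) : ℕ) : ℤ) z ρ = 0) →
      (∀ w : HeightOneSpectrum (𝓞 K), ((2 * W.conductorNorm ℤ : ℕ) : 𝓞 K) ∈ w.asIdeal →
        z ∈ selmerLocalKer (W.baseChange K) (w.adicCompletion K) ((2 ^ (L + k) : ℕ) : ℤ)) → z = 0)
    {n₀ : ℕ} (hn₀ : Squarefree n₀)
    (hn₀K : ∀ q ∈ n₀.primeFactors, Zhang2014.IsKolyvaginPrime (W.conductorNorm ℤ) W K 2 q ∧ 2 ≤ Zhang2014.kolyvaginIndex W 2 q ∧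
      FrobEqFrobInfty W K (2 ^ 2) q)
    (e₀ : KolyvaginHeegnerData Dt β ι n₀) (he₀ : addOrderOf (e₀.kolyvaginClass Nat.prime_two 2) = 2 ^ 2) :
    ∃ (R : ℕ) (Mr : ℕ → ℕ), (∀ j, Mr (j + 1) ≤ Mr j) ∧ Mr 0 = M₀ ∧ Mr R = 0 ∧
      (∀ m : ℕ, Mr (2 * m + 1) < Mr (2 * m) →
        ∀ (i : ℕ) (u : Fin i → galH1Torsion (W.baseChange K) ((2 ^ L : ℕ) : ℤ)), i ≤ 2 * m + 1 →
        (∀ j, u j ∈ selmerGroup (W.baseChange K) ((2 ^ L : ℕ) : ℤ) ∧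
          conjAct W τ ((2 ^ L : ℕ) : ℤ) (u j) = W.rootNumber • u j) →
        ∃ (n : ℕ) (_ : Squarefree n)
          (_ : ∀ ℓ ∈ n.primeFactors, Zhang2014.IsKolyvaginPrime (W.conductorNorm ℤ) W K 2 ℓ ∧ L ≤ Zhang2014.kolyvaginIndex W 2 ℓ ∧
            (L + k ≤ Zhang2014.kolyvaginIndex W 2 ℓ ∧ FrobEqFrobInfty W K (2 ^ (L + k)) ℓ))
          (d : KolyvaginHeegnerData Dt β ι n),
          (∀ ℓ ∈ n.primeFactors, ∀ e : KolyvaginHeegnerData Dt β ι (n / ℓ),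
            ((2 ^ (L - Mr (2 * m)) : ℕ) : ℤ) • e.kolyvaginClass Nat.prime_two L = 0) ∧
          addOrderOf (d.kolyvaginClass Nat.prime_two L) = 2 ^ (L - Mr (2 * m + 1)) ∧
          -W.rootNumber * (-1) ^ n.primeFactors.card = W.rootNumber ∧
          Disjoint (zmultiples (((2 ^ (L - Mr (2 * m)) : ℕ) : ℤ) • d.kolyvaginClass Nat.prime_two L))
            (AddSubgroup.closure (Set.range u))) ∧
      (∀ m : ℕ, Mr (2 * m + 2) < Mr (2 * m + 1) →
        ∀ (i : ℕ) (u : Fin i → galH1Torsion (W.baseChange K) ((2 ^ L : ℕ) : ℤ)), i ≤ 2 * m + 1 →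
        (∀ j, u j ∈ selmerGroup (W.baseChange K) ((2 ^ L : ℕ) : ℤ) ∧
          conjAct W τ ((2 ^ L : ℕ) : ℤ) (u j) = (-W.rootNumber) • u j) →
        ∃ (n : ℕ) (_ : Squarefree n)
          (_ : ∀ ℓ ∈ n.primeFactors, Zhang2014.IsKolyvaginPrime (W.conductorNorm ℤ) W K 2 ℓ ∧ L ≤ Zhang2014.kolyvaginIndex W 2 ℓ ∧
            (L + k ≤ Zhang2014.kolyvaginIndex W 2 ℓ ∧ FrobEqFrobInfty W K (2 ^ (L + k)) ℓ))
          (d : KolyvaginHeegnerData Dt β ι n),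
          (∀ ℓ ∈ n.primeFactors, ∀ e : KolyvaginHeegnerData Dt β ι (n / ℓ),
            ((2 ^ (L - Mr (2 * m + 1)) : ℕ) : ℤ) • e.kolyvaginClass Nat.prime_two L = 0) ∧
          addOrderOf (d.kolyvaginClass Nat.prime_two L) = 2 ^ (L - Mr (2 * m + 2)) ∧
          -W.rootNumber * (-1) ^ n.primeFactors.card = -W.rootNumber ∧
          Disjoint (zmultiples (((2 ^ (L - Mr (2 * m + 1)) : ℕ) : ℤ) • d.kolyvaginClass Nat.prime_two L))
            (AddSubgroup.closure (Set.range u) ⊔ zmultiples (d₁.kolyvaginClass Nat.prime_two L))) := by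
  haveI : ∀ j : ℕ, NumberField (ringClassField K ι j) := JET.numberField_ringClassField K hIQ ι
  exact kolyvaginSuppliesAtTwo_of_deepSwap_pred W hQ2 hcm hΔ hT hρ hIQ hodd h3 hHe hns τ hτ Dt β ι d₁ M₀ hM₀ hndiv (L := L)
    (by omega) k (fun z hz hzS ↦ hNPh z hz fun w _ ↦ hzS w)
    (fun q ↦ L + k ≤ Zhang2014.kolyvaginIndex W 2 q ∧ FrobEqFrobInfty W K (2 ^ (L + k)) q) (fun q _ hidx hF ↦ ⟨hidx, hF⟩)
    (TransverseValue.hbot_socket_margin_of_three_le W hQ2 hcm hΔ hT hρ hIQ hodd h3 hHe hns Dt β ι (L := L) (by omega) k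
      (by omega) hNPh _ (fun q _ hidx hF ↦ ⟨hidx, hF⟩) hn₀ hn₀K e₀ he₀)
    (deepSwap_socket W hcm hΔ hT hρ hIQ hodd h3 hns hHe τ hτ Dt β ι hQ2 hL hk hNPh)
    (fun r ℓ hℓ C hC ↦ hK_socket_margin W hΔ hIQ hτ (L := L) (by omega) r k ℓ hℓ C hC)

/-- **KS's registered conclusion WITH PROVENANCE ON THE CUT HABITAT** (odd multiplicative place: (NPh) discharged by
`NonPhantomPow.nonPhantomAtTwo_of_hasMultiplicativeReductionAt`; witness = level-`2` Gross primes of index `≥ 2` with `P(n₀) ∉ 2E(K[n₀])`) —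
gk2-p3's `kolyvaginSuppliesAtTwo_of_grossWitness_onHabitat` (p735895) re-run through `kolyvaginSuppliesAtTwo_of_deepSwap_pred`.
[cite: McCallumLMS1991, §5 Prop. 5.2] [cite: Kolyvagin1991MathAnn, Thm. 2.1–2.2] [cite: GrossLMS1991, §3 (3.3)] [cite: LawsonWuthrich2016, §7.1] -/
theorem kolyvaginSuppliesAtTwo_of_grossWitness_onHabitat_pred (W : WeierstrassCurve ℚ) [W.IsElliptic] [W.IsGloballyMinimal]
    [NeZero (W.conductorNorm ℤ)]
    (hQ2 : KolyvaginRelationAtTwo) (hcm : ¬ W.HasCM) (hΔ : W.Δ < 0) (hT : Odd W.tamagawaProduct)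
    (hρ : ∀ m : ℕ, W.HasSurjectiveModNGaloisRep (2 ^ m : ℕ))
    (hIQ : IsImaginaryQuadratic K) (hodd : Odd (NumberField.discr K)) (h3 : NumberField.discr K ≠ -3)
    (hHe : SatisfiesHeegnerHypothesis (W.conductorNorm ℤ) K) (hns : ¬ IsSquare ((NumberField.discr K : ℚ) * -|W.Δ|))
    (hns₂ : ¬ IsSquare ((NumberField.discr K : ℚ) * (-(2 * |W.Δ|))))
    {v : HeightOneSpectrum (𝓞 ℚ)} (h2v : ((2 : ℕ) : 𝓞 ℚ) ∉ v.asIdeal) (hNv : ((W.conductorNorm ℤ : ℕ) : 𝓞 ℚ) ∈ v.asIdeal)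
    (hmult : W.HasMultiplicativeReductionAt v)
    (τ : K ≃ₐ[ℚ] K) (hτ : τ ≠ 1)
    (Dt : ModularParametrizationData W (W.conductorNorm ℤ)) (β : ℤ) (ι : K →+* ℂ)
    (d₁ : KolyvaginHeegnerData Dt β ι 1) (M₀ : ℕ)
    (hM₀ : ∃ Q : (W.baseChange (ringClassField K ι 1)).toAffine.Point, ((2 ^ M₀ : ℕ) : ℤ) • Q = d₁.derivedPoint)
    (hndiv : ¬ ∃ Q : (W.baseChange (ringClassField K ι 1)).toAffine.Point, ((2 ^ (M₀ + 1) : ℕ) : ℤ) • Q = d₁.derivedPoint)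
    {L k : ℕ} (hL : 2 * M₀ + 12 ≤ L) (hk : 1 ≤ k)
    {n₀ : ℕ} (hn₀ : Squarefree n₀)
    (hn₀K : ∀ q ∈ n₀.primeFactors, Zhang2014.IsKolyvaginPrime (W.conductorNorm ℤ) W K 2 q ∧ 2 ≤ Zhang2014.kolyvaginIndex W 2 q ∧
      FrobEqFrobInfty W K 2 q)
    (e₀ : KolyvaginHeegnerData Dt β ι n₀)
    (he₀ : ¬ ∃ Q : (W.baseChange (ringClassField K ι n₀)).toAffine.Point, (2 : ℤ) • Q = e₀.derivedPoint) :
    ∃ (R : ℕ) (Mr : ℕ → ℕ), (∀ j, Mr (j + 1) ≤ Mr j) ∧ Mr 0 = M₀ ∧ Mr R = 0 ∧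
      (∀ m : ℕ, Mr (2 * m + 1) < Mr (2 * m) →
        ∀ (i : ℕ) (u : Fin i → galH1Torsion (W.baseChange K) ((2 ^ L : ℕ) : ℤ)), i ≤ 2 * m + 1 →
        (∀ j, u j ∈ selmerGroup (W.baseChange K) ((2 ^ L : ℕ) : ℤ) ∧
          conjAct W τ ((2 ^ L : ℕ) : ℤ) (u j) = W.rootNumber • u j) →
        ∃ (n : ℕ) (_ : Squarefree n)
          (_ : ∀ ℓ ∈ n.primeFactors, Zhang2014.IsKolyvaginPrime (W.conductorNorm ℤ) W K 2 ℓ ∧ L ≤ Zhang2014.kolyvaginIndex W 2 ℓ ∧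
            (L + k ≤ Zhang2014.kolyvaginIndex W 2 ℓ ∧ FrobEqFrobInfty W K (2 ^ (L + k)) ℓ))
          (d : KolyvaginHeegnerData Dt β ι n),
          (∀ ℓ ∈ n.primeFactors, ∀ e : KolyvaginHeegnerData Dt β ι (n / ℓ),
            ((2 ^ (L - Mr (2 * m)) : ℕ) : ℤ) • e.kolyvaginClass Nat.prime_two L = 0) ∧
          addOrderOf (d.kolyvaginClass Nat.prime_two L) = 2 ^ (L - Mr (2 * m + 1)) ∧
          -W.rootNumber * (-1) ^ n.primeFactors.card = W.rootNumber ∧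
          Disjoint (zmultiples (((2 ^ (L - Mr (2 * m)) : ℕ) : ℤ) • d.kolyvaginClass Nat.prime_two L))
            (AddSubgroup.closure (Set.range u))) ∧
      (∀ m : ℕ, Mr (2 * m + 2) < Mr (2 * m + 1) →
        ∀ (i : ℕ) (u : Fin i → galH1Torsion (W.baseChange K) ((2 ^ L : ℕ) : ℤ)), i ≤ 2 * m + 1 →
        (∀ j, u j ∈ selmerGroup (W.baseChange K) ((2 ^ L : ℕ) : ℤ) ∧
          conjAct W τ ((2 ^ L : ℕ) : ℤ) (u j) = (-W.rootNumber) • u j) →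
        ∃ (n : ℕ) (_ : Squarefree n)
          (_ : ∀ ℓ ∈ n.primeFactors, Zhang2014.IsKolyvaginPrime (W.conductorNorm ℤ) W K 2 ℓ ∧ L ≤ Zhang2014.kolyvaginIndex W 2 ℓ ∧
            (L + k ≤ Zhang2014.kolyvaginIndex W 2 ℓ ∧ FrobEqFrobInfty W K (2 ^ (L + k)) ℓ))
          (d : KolyvaginHeegnerData Dt β ι n),
          (∀ ℓ ∈ n.primeFactors, ∀ e : KolyvaginHeegnerData Dt β ι (n / ℓ),
            ((2 ^ (L - Mr (2 * m + 1)) : ℕ) : ℤ) • e.kolyvaginClass Nat.prime_two L = 0) ∧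
          addOrderOf (d.kolyvaginClass Nat.prime_two L) = 2 ^ (L - Mr (2 * m + 2)) ∧
          -W.rootNumber * (-1) ^ n.primeFactors.card = -W.rootNumber ∧
          Disjoint (zmultiples (((2 ^ (L - Mr (2 * m + 1)) : ℕ) : ℤ) • d.kolyvaginClass Nat.prime_two L))
            (AddSubgroup.closure (Set.range u) ⊔ zmultiples (d₁.kolyvaginClass Nat.prime_two L))) := by
  haveI : ∀ j : ℕ, NumberField (ringClassField K ι j) := JET.numberField_ringClassField K hIQ ι
  have hρ' : ∀ n : ℕ, 0 < n → W.HasSurjectiveModNGaloisRep ((2 : ℤ) ^ n) := fun n _ ↦ by exact_mod_cast hρ n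
  have hNPh := NonPhantomPow.nonPhantomAtTwo_of_hasMultiplicativeReductionAt W hT hρ' hIQ hodd hns hns₂
    (NeZero.ne (W.conductorNorm ℤ)) hHe h2v hNv hmult (L + k) (by omega)
  exact kolyvaginSuppliesAtTwo_of_deepSwap_pred W hQ2 hcm hΔ hT hρ hIQ hodd h3 hHe hns τ hτ Dt β ι d₁ M₀ hM₀ hndiv (L := L)
    (by omega) k (fun z hz hzS ↦ hNPh z hz fun w _ ↦ hzS w)
    (fun q ↦ L + k ≤ Zhang2014.kolyvaginIndex W 2 q ∧ FrobEqFrobInfty W K (2 ^ (L + k)) q) (fun q _ hidx hF ↦ ⟨hidx, hF⟩)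
    (TransverseValue.hbot_socket_margin_onHabitat_of_three_le W hQ2 hcm hΔ hT hρ hIQ hodd h3 hHe hns hns₂ h2v hNv hmult Dt β ι
      (L := L) (by omega) k (by omega) _ (fun q _ hidx hF ↦ ⟨hidx, hF⟩) hn₀ hn₀K e₀ he₀)
    (deepSwap_socket W hcm hΔ hT hρ hIQ hodd h3 hns hHe τ hτ Dt β ι hQ2 hL hk hNPh)
    (fun r ℓ hℓ C hC ↦ hK_socket_margin W hΔ hIQ hτ (L := L) (by omega) r k ℓ hℓ C hC)
/-! ## §2 Road (E4) assembled: L_T's conclusion from a Gross witness modulo X-ORTH -/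

/-- **THE (E4) CLOSER MODULO ITS SOCKET — `2N`-form.**  On L_T's frame (see the module docstring) with a level `L ≥ 2M₀ + 12`, a margin
`kₘ ≥ 1` and a pairing exponent `k ≥ M₀`: from (P) (Kolyvagin conjunct), Q2, (NPh_{L+kₘ}) in `2N`-form, a LEVEL-4 GROSS WITNESS (`addOrderOf c₂(n₀) = 4`
at level-4 Gross primes of index `≥ 2`), a bi-additive `B` on `Ш(E_K)[2^k]` with the level clause and X-ORTH for the margin class:
`2^{2M₀} ∣ #Ш(E_K)[2^∞]`. [cite: McCallumLMS1991, §4 Prop. 4.7, §5 Prop. 5.2, Thm. 5.4 (p. 310)] [cite: Kolyvagin1991StructureSha]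
[cite: GrossLMS1991, §3 (3.1)–(3.3), §5 Prop. 5.3–5.4] -/
theorem pow_dvd_natCard_sha_of_grossWitness_of_orthogonal (hP : PubInputsAtTwo) (hQ2 : KolyvaginRelationAtTwo)
    (W : WeierstrassCurve ℚ) [W.IsElliptic] [W.IsGloballyMinimal] [NeZero (W.conductorNorm ℤ)] (hcm : ¬ W.HasCM)
    (hT : Odd W.tamagawaProduct) (hΔ : W.Δ < 0) (K : Type) [Field K] [NumberField K] (hIQ : IsImaginaryQuadratic K)
    (hodd : Odd (NumberField.discr K)) (h3 : NumberField.discr K ≠ -3) (hHe : SatisfiesHeegnerHypothesis (W.conductorNorm ℤ) K)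
    (hns : ¬ IsSquare ((NumberField.discr K : ℚ) * -|W.Δ|))
    (hρ : ∀ n : ℕ, 0 < n → W.HasSurjectiveModNGaloisRep ((2 : ℤ) ^ n))
    (Dt : ModularParametrizationData W (W.conductorNorm ℤ)) (β : ℤ) (ι : K →+* ℂ) (d₁ : KolyvaginHeegnerData Dt β ι 1)
    (hy : ¬ IsOfFinAddOrder d₁.derivedPoint) (M₀ : ℕ)
    (hM₀ : ∃ Q : (W.baseChange (ringClassField K ι 1)).toAffine.Point, ((2 ^ M₀ : ℕ) : ℤ) • Q = d₁.derivedPoint)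
    (hndiv : ¬ ∃ Q : (W.baseChange (ringClassField K ι 1)).toAffine.Point, ((2 ^ (M₀ + 1) : ℕ) : ℤ) • Q = d₁.derivedPoint)
    (τ : K ≃ₐ[ℚ] K) (hτ : τ ≠ 1) (L kₘ k : ℕ) (hL : 2 * M₀ + 12 ≤ L) (hkₘ : 1 ≤ kₘ) (hkM : M₀ ≤ k)
    (hNPh : ∀ z : galH1Torsion (W.baseChange K) ((2 ^ (L + kₘ) : ℕ) : ℤ),
      (∀ ρ ∈ torsionFixing (W.baseChange K) ((2 ^ (L + kₘ) : ℕ) : ℤ),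
        h1Eval (W.baseChange K) ((2 ^ (L + kₘ) : ℕ) : ℤ) z ρ = 0) →
      (∀ w : HeightOneSpectrum (𝓞 K), ((2 * W.conductorNorm ℤ : ℕ) : 𝓞 K) ∈ w.asIdeal →
        z ∈ selmerLocalKer (W.baseChange K) (w.adicCompletion K) ((2 ^ (L + kₘ) : ℕ) : ℤ)) → z = 0)
    {n₀ : ℕ} (hn₀ : Squarefree n₀)
    (hn₀K : ∀ q ∈ n₀.primeFactors, Zhang2014.IsKolyvaginPrime (W.conductorNorm ℤ) W K 2 q ∧ 2 ≤ Zhang2014.kolyvaginIndex W 2 q ∧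
      FrobEqFrobInfty W K (2 ^ 2) q)
    (e₀ : KolyvaginHeegnerData Dt β ι n₀) (he₀ : addOrderOf (e₀.kolyvaginClass Nat.prime_two 2) = 2 ^ 2)
    (B : ↥((↥(W.baseChange K).sha)[((2 ^ k : ℕ) : ℤ)]) →+ ↥((↥(W.baseChange K).sha)[((2 ^ k : ℕ) : ℤ)]) →+ AddCircle (1 : ℚ))
    (hker : ∀ x : ↥((↥(W.baseChange K).sha)[((2 ^ k : ℕ) : ℤ)]), B x = 0 →
      ∃ z : (W.baseChange K).sha, (2 ^ k) • z = (x : (W.baseChange K).sha))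
    (hOrth : ∀ x x' : ↥((↥(W.baseChange K).sha)[((2 ^ k : ℕ) : ℤ)]),
      (∃ (n : ℕ) (d : KolyvaginHeegnerData Dt β ι n) (e : ℕ), Squarefree n ∧
        (∀ ℓ ∈ n.primeFactors, Zhang2014.IsKolyvaginPrime (W.conductorNorm ℤ) W K 2 ℓ ∧ L ≤ Zhang2014.kolyvaginIndex W 2 ℓ ∧
          (L + kₘ ≤ Zhang2014.kolyvaginIndex W 2 ℓ ∧ FrobEqFrobInfty W K (2 ^ (L + kₘ)) ℓ)) ∧
        e ≤ k ∧
        ((2 ^ (L - e) : ℕ) : ℤ) • d.kolyvaginClass Nat.prime_two L ∈ selmerGroup (W.baseChange K) ((2 ^ L : ℕ) : ℤ) ∧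
        (∀ ℓ ∈ n.primeFactors, ∀ u : HeightOneSpectrum (𝓞 K), ((ℓ : ℕ) : 𝓞 K) ∈ u.asIdeal →
          ((2 ^ (L - e) : ℕ) : ℤ) • d.kolyvaginClass Nat.prime_two L ∈
            (W.baseChange K).torsionLocalKer (u.adicCompletion K) ((2 ^ L : ℕ) : ℤ)) ∧
        conjAct W τ ((2 ^ L : ℕ) : ℤ) (((2 ^ (L - e) : ℕ) : ℤ) • d.kolyvaginClass Nat.prime_two L) =
          W.rootNumber • (((2 ^ (L - e) : ℕ) : ℤ) • d.kolyvaginClass Nat.prime_two L) ∧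
        ((x : (W.baseChange K).sha) : (W.baseChange K).galH1) =
          torsionH1ToH1 (W.baseChange K) ((2 ^ L : ℕ) : ℤ) (((2 ^ (L - e) : ℕ) : ℤ) • d.kolyvaginClass Nat.prime_two L)) →
      (∃ (n : ℕ) (d : KolyvaginHeegnerData Dt β ι n) (e : ℕ), Squarefree n ∧
        (∀ ℓ ∈ n.primeFactors, Zhang2014.IsKolyvaginPrime (W.conductorNorm ℤ) W K 2 ℓ ∧ L ≤ Zhang2014.kolyvaginIndex W 2 ℓ ∧
          (L + kₘ ≤ Zhang2014.kolyvaginIndex W 2 ℓ ∧ FrobEqFrobInfty W K (2 ^ (L + kₘ)) ℓ)) ∧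
        e ≤ k ∧
        ((2 ^ (L - e) : ℕ) : ℤ) • d.kolyvaginClass Nat.prime_two L ∈ selmerGroup (W.baseChange K) ((2 ^ L : ℕ) : ℤ) ∧
        (∀ ℓ ∈ n.primeFactors, ∀ u : HeightOneSpectrum (𝓞 K), ((ℓ : ℕ) : 𝓞 K) ∈ u.asIdeal →
          ((2 ^ (L - e) : ℕ) : ℤ) • d.kolyvaginClass Nat.prime_two L ∈
            (W.baseChange K).torsionLocalKer (u.adicCompletion K) ((2 ^ L : ℕ) : ℤ)) ∧
        conjAct W τ ((2 ^ L : ℕ) : ℤ) (((2 ^ (L - e) : ℕ) : ℤ) • d.kolyvaginClass Nat.prime_two L) =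
          (-W.rootNumber) • (((2 ^ (L - e) : ℕ) : ℤ) • d.kolyvaginClass Nat.prime_two L) ∧
        ((x' : (W.baseChange K).sha) : (W.baseChange K).galH1) =
          torsionH1ToH1 (W.baseChange K) ((2 ^ L : ℕ) : ℤ) (((2 ^ (L - e) : ℕ) : ℤ) • d.kolyvaginClass Nat.prime_two L)) →
      B x x' = 0) :
    2 ^ (2 * M₀) ∣ Nat.card (AddCommGroup.primaryComponent (W.baseChange K).sha 2) := by
  have hsurN : ∀ m : ℕ, W.HasSurjectiveModNGaloisRep ((2 ^ m : ℕ) : ℤ) :=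
    MinimalTwinBSDTwo.forall_hasSurjectiveModNGaloisRep_two_pow_of_pos W hρ
  have hsurN' : ∀ m : ℕ, W.HasSurjectiveModNGaloisRep (2 ^ m : ℕ) := fun m ↦ by exact_mod_cast hsurN m
  obtain ⟨R, Mr, hMr, hMr0, hMrR, hOdd, hEven⟩ := kolyvaginSuppliesAtTwo_of_grossWitness_pred W hQ2 hcm hΔ hT hsurN' hIQ hodd h3 hHe hns
    τ hτ Dt β ι d₁ M₀ hM₀ hndiv (L := L) (k := kₘ) hL hkₘ hNPh hn₀ hn₀K e₀ he₀
  exact pow_dvd_natCard_sha_of_kolyvaginSupplies_of_orthogonal hP hQ2 W hcm hT K hIQ hodd h3 hHe hρ Dt β ι d₁ hy M₀ hndiv τ hτ L k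
    (by omega) hkM (fun ℓ ↦ L + kₘ ≤ Zhang2014.kolyvaginIndex W 2 ℓ ∧ FrobEqFrobInfty W K (2 ^ (L + kₘ)) ℓ)
    (fun ℓ ↦ L + kₘ ≤ Zhang2014.kolyvaginIndex W 2 ℓ ∧ FrobEqFrobInfty W K (2 ^ (L + kₘ)) ℓ) B hker hOrth R Mr hMr hMr0 hMrR hOdd hEven

/-- **THE (E4) CLOSER MODULO ITS SOCKET — ON THE CUT HABITAT (L_T's rev-33 frame).**  As `pow_dvd_natCard_sha_of_grossWitness_of_orthogonal`, with
(NPh) DISCHARGED by an odd place of multiplicative reduction (`v`, `2 ∉ v`, `N ∈ v`; the (D-NPh) binder of L_T) and the second non-square clause, and the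
witness in divisibility currency at LEVEL-2 Gross primes of index `≥ 2` (`P(n₀) ∉ 2E(K[n₀])` — the (β″) witness clause / W-UP's output).
Displayed: (P), Q2, `B` + level clause, X-ORTH.  Conclusion: L_T's. [cite: McCallumLMS1991, §4 Prop. 4.7, §5 Prop. 5.2, Thm. 5.4 (p. 310)]
[cite: Kolyvagin1991StructureSha] [cite: GrossLMS1991, §3 (3.3), §5 Prop. 5.3–5.4] [cite: LawsonWuthrich2016, §7.1] -/
theorem pow_dvd_natCard_sha_of_grossWitness_of_orthogonal_onHabitat (hP : PubInputsAtTwo) (hQ2 : KolyvaginRelationAtTwo)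
    (W : WeierstrassCurve ℚ) [W.IsElliptic] [W.IsGloballyMinimal] [NeZero (W.conductorNorm ℤ)] (hcm : ¬ W.HasCM)
    (hT : Odd W.tamagawaProduct) (hΔ : W.Δ < 0) (K : Type) [Field K] [NumberField K] (hIQ : IsImaginaryQuadratic K)
    (hodd : Odd (NumberField.discr K)) (h3 : NumberField.discr K ≠ -3) (hHe : SatisfiesHeegnerHypothesis (W.conductorNorm ℤ) K)
    (hns : ¬ IsSquare ((NumberField.discr K : ℚ) * -|W.Δ|))
    (hns₂ : ¬ IsSquare ((NumberField.discr K : ℚ) * (-(2 * |W.Δ|))))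
    {v : HeightOneSpectrum (𝓞 ℚ)} (h2v : ((2 : ℕ) : 𝓞 ℚ) ∉ v.asIdeal) (hNv : ((W.conductorNorm ℤ : ℕ) : 𝓞 ℚ) ∈ v.asIdeal)
    (hmult : W.HasMultiplicativeReductionAt v)
    (hρ : ∀ n : ℕ, 0 < n → W.HasSurjectiveModNGaloisRep ((2 : ℤ) ^ n))
    (Dt : ModularParametrizationData W (W.conductorNorm ℤ)) (β : ℤ) (ι : K →+* ℂ) (d₁ : KolyvaginHeegnerData Dt β ι 1)
    (hy : ¬ IsOfFinAddOrder d₁.derivedPoint) (M₀ : ℕ)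
    (hM₀ : ∃ Q : (W.baseChange (ringClassField K ι 1)).toAffine.Point, ((2 ^ M₀ : ℕ) : ℤ) • Q = d₁.derivedPoint)
    (hndiv : ¬ ∃ Q : (W.baseChange (ringClassField K ι 1)).toAffine.Point, ((2 ^ (M₀ + 1) : ℕ) : ℤ) • Q = d₁.derivedPoint)
    (τ : K ≃ₐ[ℚ] K) (hτ : τ ≠ 1) (L kₘ k : ℕ) (hL : 2 * M₀ + 12 ≤ L) (hkₘ : 1 ≤ kₘ) (hkM : M₀ ≤ k)
    {n₀ : ℕ} (hn₀ : Squarefree n₀)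
    (hn₀K : ∀ q ∈ n₀.primeFactors, Zhang2014.IsKolyvaginPrime (W.conductorNorm ℤ) W K 2 q ∧ 2 ≤ Zhang2014.kolyvaginIndex W 2 q ∧
      FrobEqFrobInfty W K 2 q)
    (e₀ : KolyvaginHeegnerData Dt β ι n₀)
    (he₀ : ¬ ∃ Q : (W.baseChange (ringClassField K ι n₀)).toAffine.Point, (2 : ℤ) • Q = e₀.derivedPoint)
    (B : ↥((↥(W.baseChange K).sha)[((2 ^ k : ℕ) : ℤ)]) →+ ↥((↥(W.baseChange K).sha)[((2 ^ k : ℕ) : ℤ)]) →+ AddCircle (1 : ℚ))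
    (hker : ∀ x : ↥((↥(W.baseChange K).sha)[((2 ^ k : ℕ) : ℤ)]), B x = 0 →
      ∃ z : (W.baseChange K).sha, (2 ^ k) • z = (x : (W.baseChange K).sha))
    (hOrth : ∀ x x' : ↥((↥(W.baseChange K).sha)[((2 ^ k : ℕ) : ℤ)]),
      (∃ (n : ℕ) (d : KolyvaginHeegnerData Dt β ι n) (e : ℕ), Squarefree n ∧
        (∀ ℓ ∈ n.primeFactors, Zhang2014.IsKolyvaginPrime (W.conductorNorm ℤ) W K 2 ℓ ∧ L ≤ Zhang2014.kolyvaginIndex W 2 ℓ ∧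
          (L + kₘ ≤ Zhang2014.kolyvaginIndex W 2 ℓ ∧ FrobEqFrobInfty W K (2 ^ (L + kₘ)) ℓ)) ∧
        e ≤ k ∧
        ((2 ^ (L - e) : ℕ) : ℤ) • d.kolyvaginClass Nat.prime_two L ∈ selmerGroup (W.baseChange K) ((2 ^ L : ℕ) : ℤ) ∧
        (∀ ℓ ∈ n.primeFactors, ∀ u : HeightOneSpectrum (𝓞 K), ((ℓ : ℕ) : 𝓞 K) ∈ u.asIdeal →
          ((2 ^ (L - e) : ℕ) : ℤ) • d.kolyvaginClass Nat.prime_two L ∈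
            (W.baseChange K).torsionLocalKer (u.adicCompletion K) ((2 ^ L : ℕ) : ℤ)) ∧
        conjAct W τ ((2 ^ L : ℕ) : ℤ) (((2 ^ (L - e) : ℕ) : ℤ) • d.kolyvaginClass Nat.prime_two L) =
          W.rootNumber • (((2 ^ (L - e) : ℕ) : ℤ) • d.kolyvaginClass Nat.prime_two L) ∧
        ((x : (W.baseChange K).sha) : (W.baseChange K).galH1) =
          torsionH1ToH1 (W.baseChange K) ((2 ^ L : ℕ) : ℤ) (((2 ^ (L - e) : ℕ) : ℤ) • d.kolyvaginClass Nat.prime_two L)) →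
      (∃ (n : ℕ) (d : KolyvaginHeegnerData Dt β ι n) (e : ℕ), Squarefree n ∧
        (∀ ℓ ∈ n.primeFactors, Zhang2014.IsKolyvaginPrime (W.conductorNorm ℤ) W K 2 ℓ ∧ L ≤ Zhang2014.kolyvaginIndex W 2 ℓ ∧
          (L + kₘ ≤ Zhang2014.kolyvaginIndex W 2 ℓ ∧ FrobEqFrobInfty W K (2 ^ (L + kₘ)) ℓ)) ∧
        e ≤ k ∧
        ((2 ^ (L - e) : ℕ) : ℤ) • d.kolyvaginClass Nat.prime_two L ∈ selmerGroup (W.baseChange K) ((2 ^ L : ℕ) : ℤ) ∧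
        (∀ ℓ ∈ n.primeFactors, ∀ u : HeightOneSpectrum (𝓞 K), ((ℓ : ℕ) : 𝓞 K) ∈ u.asIdeal →
          ((2 ^ (L - e) : ℕ) : ℤ) • d.kolyvaginClass Nat.prime_two L ∈
            (W.baseChange K).torsionLocalKer (u.adicCompletion K) ((2 ^ L : ℕ) : ℤ)) ∧
        conjAct W τ ((2 ^ L : ℕ) : ℤ) (((2 ^ (L - e) : ℕ) : ℤ) • d.kolyvaginClass Nat.prime_two L) =
          (-W.rootNumber) • (((2 ^ (L - e) : ℕ) : ℤ) • d.kolyvaginClass Nat.prime_two L) ∧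
        ((x' : (W.baseChange K).sha) : (W.baseChange K).galH1) =
          torsionH1ToH1 (W.baseChange K) ((2 ^ L : ℕ) : ℤ) (((2 ^ (L - e) : ℕ) : ℤ) • d.kolyvaginClass Nat.prime_two L)) →
      B x x' = 0) :
    2 ^ (2 * M₀) ∣ Nat.card (AddCommGroup.primaryComponent (W.baseChange K).sha 2) := by
  have hsurN : ∀ m : ℕ, W.HasSurjectiveModNGaloisRep ((2 ^ m : ℕ) : ℤ) :=
    MinimalTwinBSDTwo.forall_hasSurjectiveModNGaloisRep_two_pow_of_pos W hρ
  have hsurN' : ∀ m : ℕ, W.HasSurjectiveModNGaloisRep (2 ^ m : ℕ) := fun m ↦ by exact_mod_cast hsurN m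
  obtain ⟨R, Mr, hMr, hMr0, hMrR, hOdd, hEven⟩ := kolyvaginSuppliesAtTwo_of_grossWitness_onHabitat_pred W hQ2 hcm hΔ hT hsurN' hIQ hodd
    h3 hHe hns hns₂ h2v hNv hmult τ hτ Dt β ι d₁ M₀ hM₀ hndiv (L := L) (k := kₘ) hL hkₘ hn₀ hn₀K e₀ he₀
  exact pow_dvd_natCard_sha_of_kolyvaginSupplies_of_orthogonal hP hQ2 W hcm hT K hIQ hodd h3 hHe hρ Dt β ι d₁ hy M₀ hndiv τ hτ L k
    (by omega) hkM (fun ℓ ↦ L + kₘ ≤ Zhang2014.kolyvaginIndex W 2 ℓ ∧ FrobEqFrobInfty W K (2 ^ (L + kₘ)) ℓ)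
    (fun ℓ ↦ L + kₘ ≤ Zhang2014.kolyvaginIndex W 2 ℓ ∧ FrobEqFrobInfty W K (2 ^ (L + kₘ)) ℓ) B hker hOrth R Mr hMr hMr0 hMrR hOdd hEven


end Summit.BirchSwinnertonDyer.BirchSwinnertonDyer.Theorems.GenusExact.PlusDescent

end
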